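import Summits.KontsevichZagierPeriods.KontsevichZagierPeriods.Theorems.RootDecompRelativeModAbsoluteRegFoldingDegOneP11

/-!
# `RegFoldingDegOne` (route `RootDecompRelativeModAbsolute`, support item stmt-KontsevichZagierPeriods-30571) — PROVED · part 12/14

Cell `decomp-kz`, lens 3 (decomp-kz-lens-3 g9): `regFoldingDegOne_holds :
Theses.RootDecompRelativeModAbsolute.RegFoldingDegOne` BY NAME (in part 14/14) — every Kontsevich–Zagier
integral representation on `ℝ²` whose integrand is a quotient `p/q` of `ℚ`-polynomials with `deg_t q ≤ 1`,
`q ≠ 0` on the domain, is equivalent in `KZ.relations` to `[g] + Σᵢ [Uᵢ]`, the `Uᵢ` honest 2-cells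
`[g.domain × (0,1), hᵢ(x) θ^{Mᵢ}/(1 + θ^{eᵢ} κᵢ(x))]` (unfolded REGULARISED log/arctan monomials), with the
fibre integrals matching a.e.  Architecture: §1–§2 regularised terms `RTerm`, `RegFolding d`; §7 a.e.-congruence;
§8 gluing (`FoldsTo`); §9 one-band toolkit; §P analytic core (kernel independence); §10 cylinders; §11 affine band
chart; §13 `RegFolding 1` from a CAD band cover a.e. + vanishing on unbounded bands; last part: the edge to the born
item text and `regFoldingDegOne_holds`.

Source: `HOME/decomp-kz-lens-3/g9/landing/RootDecompRelativeModAbsoluteRegFoldingDegOne.lean` sha256 60038aa44a5f6303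
(4275 l; critic decomp-kz-crit-1 g2 CLEARED/kernel-confirmed 2026-08-30T09:41:19Z, std axioms), split mechanically
into 14 modules ≤ 400 lines by the landing seat decomp-kz-census-1 g7 (contexts re-opened per part; generic docstrings
added where the source had none; parts 1–13 do not import the route file).  No `sorry`; standard axioms.
References: [cite: KontsevichZagier2001, §1.2]; Basu–Pollack–Roy 2006 Def. 5.1 / Cor. 5.7; Bochnak–Coste–Roy 1998 §2.9.
-/

noncomputable section

open Set MeasureTheory Filter Topology
open scoped BigOperators
open Literature.NumberTheory.Transcendental Literature.ModelTheory.ExponentialFields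

namespace Summit.KontsevichZagierPeriods.RootDecompRelativeModAbsolute.Rung30571

-- PRIVATE copy (landed twin in farm-unbuilt HyperbolicBloch module; dedup.landed): isSemialgebraicFunOn_finset_sum
/-- Finite sums of `ℚ`-semialgebraic functions are `ℚ`-semialgebraic. [BCR 1998, Prop. 2.2.6] -/
private theorem isSemialgebraicFunOn_finset_sum {n : ℕ} {s : Set (Fin n → ℝ)} (hs : IsSemialgebraic ℚ s)
    {ι : Type*} (I : Finset ι) {f : ι → (Fin n → ℝ) → ℝ}
    (hf : ∀ i ∈ I, IsSemialgebraicFunOn ℚ s (f i)) :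
    IsSemialgebraicFunOn ℚ s (fun x => ∑ i ∈ I, f i x) := by
  classical
  induction I using Finset.induction_on with
  | empty => exact (isSemialgebraicFunOn_ratCast hs 0).congr fun x _ => by simp
  | insert a I ha ih =>
    have h1 : IsSemialgebraicFunOn ℚ s (f a) := hf a (Finset.mem_insert_self a I)
    have h2 := ih fun i hi => hf i (Finset.mem_insert_of_mem hi)
    refine (IsSemialgebraicFunOn.add_holds h1 h2).congr fun x _ => ?_
    simp only [Pi.add_apply, Finset.sum_insert ha]

namespace RegularisedLogLayer

section AffineChart

variable {b : ℕ}

/-- **Binomial re-expansion of the numerator under the chart** `t = α + σθ`. [elementary algebra] -/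
theorem chart_numerator (n : ℕ) (p : ℕ → ℝ) (α σ θ : ℝ) :
    σ * ∑ i ∈ Finset.range (n + 1), p i * (α + σ * θ) ^ i =
      ∑ j ∈ Finset.range (n + 1), chartCoeff n p α σ j * θ ^ j := by
  have e : ∀ i ∈ Finset.range (n + 1), p i * (α + σ * θ) ^ i =
      ∑ j ∈ Finset.range (n + 1),
        if j ≤ i then p i * α ^ (i - j) * σ ^ j * (i.choose j : ℝ) * θ ^ j else 0 := by
    intro i hi
    rw [Finset.mem_range] at hi
    rw [add_comm, add_pow, Finset.mul_sum, ← Finset.sum_filter]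
    have hf : (Finset.range (n + 1)).filter (fun j => j ≤ i) = Finset.range (i + 1) := by
      ext j
      simp only [Finset.mem_filter, Finset.mem_range]
      omega
    rw [hf]
    refine Finset.sum_congr rfl fun j _ => ?_
    rw [mul_pow]
    ring
  rw [Finset.mul_sum, Finset.sum_congr rfl (fun i hi => by rw [e i hi])]
  simp only [Finset.mul_sum]
  rw [Finset.sum_comm]
  refine Finset.sum_congr rfl fun j _ => ?_
  rw [chartCoeff, Finset.mul_sum, Finset.sum_mul]
  refine Finset.sum_congr rfl fun i _ => ?_
  split_ifs
  · ring
  · simp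

/-- `isSemialgebraicFunOn_chartCoeff`: auxiliary theorem of the `RegFoldingDegOne` (stmt-30571) development — see the module docstring; statement and proof verbatim from the lens-3 g9 landing file. -/
theorem isSemialgebraicFunOn_chartCoeff {S : Set (Fin b → ℝ)} (hS : IsSemialgebraic ℚ S) (n : ℕ)
    {p : ℕ → (Fin b → ℝ) → ℝ} (hp : ∀ i, IsSemialgebraicFunOn ℚ S (p i))
    {α σ : (Fin b → ℝ) → ℝ} (hα : IsSemialgebraicFunOn ℚ S α) (hσ : IsSemialgebraicFunOn ℚ S σ)
    (j : ℕ) : IsSemialgebraicFunOn ℚ S (fun x => chartCoeff n (fun i => p i x) (α x) (σ x) j) := by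
  unfold chartCoeff
  refine IsSemialgebraicFunOn.mul_holds hσ (isSemialgebraicFunOn_finset_sum hS _ fun i _ => ?_)
  by_cases hji : j ≤ i
  · simp only [if_pos hji]
    exact IsSemialgebraicFunOn.mul_holds
      (IsSemialgebraicFunOn.mul_holds
        (IsSemialgebraicFunOn.mul_holds (hp i) (isSemialgebraicFunOn_pow hS hα (i - j)))
        (isSemialgebraicFunOn_pow hS hσ j))
      ((isSemialgebraicFunOn_ratCast hS (i.choose j : ℚ)).congr fun x _ => by simp)
  · simp only [if_neg hji]
    exact (isSemialgebraicFunOn_ratCast hS 0).congr fun x _ => by simp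

/-- **Integrability pulls back along the affine band chart** `Φ(x,θ) = (x, α(x) + (β−α)(x)θ)` from
the open band `{α < t < β}` over an open `G` to the cylinder `G × (0,1)` (Jacobian `β − α`).
[folklore; Mathlib `integrableOn_image_iff_integrableOn_abs_det_fderiv_smul`] -/
theorem integrableOn_affinePullback {G : Set (Fin b → ℝ)} (hGo : IsOpen G)
    (hG : IsSemialgebraic ℚ G) {α β : (Fin b → ℝ) → ℝ} (hαd : DifferentiableOn ℝ α G)
    (hβd : DifferentiableOn ℝ β G) (hlt : ∀ x ∈ G, α x < β x) {f : (Fin (b + 1) → ℝ) → ℝ}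
    (hf : IntegrableOn f {z : Fin (b + 1) → ℝ | (Fin.init z : Fin b → ℝ) ∈ G ∧
      α (Fin.init z) < z (Fin.last b) ∧ z (Fin.last b) < β (Fin.init z)}) :
    IntegrableOn (fun w => (β (Fin.init w) - α (Fin.init w)) *
      f (Fin.snoc (Fin.init w)
        (α (Fin.init w) + (β (Fin.init w) - α (Fin.init w)) * w (Fin.last b)))) (RTerm.cyl G) := by
  have hαd' : ∀ y ∈ G, HasFDerivAt α (fderiv ℝ α y) y := fun y hy =>
    ((hαd y hy).differentiableAt (hGo.mem_nhds hy)).hasFDerivAt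
  have hβd' : ∀ y ∈ G, HasFDerivAt β (fderiv ℝ β y) y := fun y hy =>
    ((hβd y hy).differentiableAt (hGo.mem_nhds hy)).hasFDerivAt
  have hσd' : ∀ y ∈ G, HasFDerivAt (fun y => β y - α y) (fderiv ℝ β y - fderiv ℝ α y) y :=
    fun y hy => (hβd' y hy).sub (hαd' y hy)
  have hσpos : ∀ y ∈ G, 0 < β y - α y := fun y hy => sub_pos.2 (hlt y hy)
  -- the substitution
  set Φ : (Fin (b + 1) → ℝ) → (Fin (b + 1) → ℝ) := fun z =>
    Fin.snoc (Fin.init z) (α (Fin.init z) + (β (Fin.init z) - α (Fin.init z)) * z (Fin.last b))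
    with hΦ
  let initL : (Fin (b + 1) → ℝ) →L[ℝ] (Fin b → ℝ) :=
    ContinuousLinearMap.pi fun i => ContinuousLinearMap.proj (Fin.castSucc i)
  let lastL : (Fin (b + 1) → ℝ) →L[ℝ] ℝ := ContinuousLinearMap.proj (Fin.last b)
  have hinitL : ∀ w, initL w = Fin.init w := fun w => rfl
  have hlastL : ∀ w, lastL w = w (Fin.last b) := fun w => rfl
  let row : (Fin (b + 1) → ℝ) → (Fin (b + 1) → ℝ) →L[ℝ] ℝ := fun z =>
    (fderiv ℝ α (Fin.init z)).comp initL +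
      z (Fin.last b) • (fderiv ℝ β (Fin.init z) - fderiv ℝ α (Fin.init z)).comp initL +
        (β (Fin.init z) - α (Fin.init z)) • lastL
  have hrow : ∀ z w, row z w = fderiv ℝ α (Fin.init z) (Fin.init w) +
      z (Fin.last b) * (fderiv ℝ β (Fin.init z) (Fin.init w) - fderiv ℝ α (Fin.init z) (Fin.init w)) +
        (β (Fin.init z) - α (Fin.init z)) * w (Fin.last b) := by
    intro z w
    simp [row, hinitL, hlastL]
  let Φ' : (Fin (b + 1) → ℝ) → (Fin (b + 1) → ℝ) →L[ℝ] (Fin (b + 1) → ℝ) := fun z =>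
    ContinuousLinearMap.pi
      (Fin.lastCases (motive := fun _ => (Fin (b + 1) → ℝ) →L[ℝ] ℝ) (row z)
        (fun i => ContinuousLinearMap.proj (Fin.castSucc i)))
  have hΦ' : ∀ z w, Φ' z w = Fin.snoc (Fin.init w) (row z w) := by
    intro z w
    funext i
    refine Fin.lastCases ?_ (fun j => ?_) i
    · simp [Φ']
    · simp [Φ', Fin.init]
  -- determinant
  have hdet : ∀ z, (Φ' z).det = β (Fin.init z) - α (Fin.init z) := by
    intro z
    have h := LinearMap.det_of_snoc_init (Φ' z : (Fin (b + 1) → ℝ) →ₗ[ℝ] (Fin (b + 1) → ℝ))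
      LinearMap.id
      (((fderiv ℝ α (Fin.init z) : (Fin b → ℝ) →L[ℝ] ℝ) +
        z (Fin.last b) • (fderiv ℝ β (Fin.init z) - fderiv ℝ α (Fin.init z))) :
          (Fin b → ℝ) →ₗ[ℝ] ℝ)
      (β (Fin.init z) - α (Fin.init z)) (fun w => by
        rw [ContinuousLinearMap.coe_coe, hΦ', hrow]
        simp)
    rw [LinearMap.det_id, mul_one] at h
    exact h
  -- derivative
  have hderiv : ∀ z : Fin (b + 1) → ℝ, Fin.init z ∈ G → HasFDerivAt Φ (Φ' z) z := by
    intro z hz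
    rw [hasFDerivAt_pi']
    intro i
    refine Fin.lastCases ?_ (fun j => ?_) i
    · have h1 : HasFDerivAt (fun x : Fin (b + 1) → ℝ => Fin.init x) initL z := initL.hasFDerivAt
      have hαc := (hαd' _ hz).comp z h1
      have hσc := (hσd' _ hz).comp z h1
      have hl : HasFDerivAt (fun x : Fin (b + 1) → ℝ => x (Fin.last b)) lastL z :=
        hasFDerivAt_apply (Fin.last b) z
      have h := hαc.add (hσc.mul hl)
      have hfun : (fun x => Φ x (Fin.last b)) =
          fun x => (α ∘ fun x : Fin (b + 1) → ℝ => Fin.init x) x +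
            ((fun y => β y - α y) ∘ fun x : Fin (b + 1) → ℝ => Fin.init x) x * x (Fin.last b) := by
        funext x
        simp [hΦ]
      show HasFDerivAt (fun x => Φ x (Fin.last b)) _ z
      rw [hfun]
      refine h.congr_fderiv (ContinuousLinearMap.ext fun w => ?_)
      simp only [ContinuousLinearMap.coe_comp, Function.comp_apply, hΦ', hrow]
      simp [hinitL, hlastL]
      ring
    · have hfun : (fun x => Φ x (Fin.castSucc j)) = fun x => x (Fin.castSucc j) := by
        funext x
        simp [hΦ, Fin.init]
      show HasFDerivAt (fun x => Φ x (Fin.castSucc j)) _ z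
      rw [hfun]
      refine (hasFDerivAt_apply (Fin.castSucc j) z).congr_fderiv
        (ContinuousLinearMap.ext fun w => ?_)
      simp [hΦ', Fin.init]
  -- injectivity on the cylinder
  have hinj : InjOn Φ (RTerm.cyl G) := by
    intro z₁ hz₁ z₂ hz₂ h
    have hy : Fin.init z₁ = Fin.init z₂ := by
      have := congrArg Fin.init h
      simpa [hΦ] using this
    have hl : α (Fin.init z₁) + (β (Fin.init z₁) - α (Fin.init z₁)) * z₁ (Fin.last b) =
        α (Fin.init z₂) + (β (Fin.init z₂) - α (Fin.init z₂)) * z₂ (Fin.last b) := by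
      have := congrFun h (Fin.last b)
      simpa [hΦ] using this
    rw [hy] at hl
    have hs : z₁ (Fin.last b) = z₂ (Fin.last b) :=
      mul_left_cancel₀ (hσpos _ hz₂.1).ne' (add_left_cancel hl)
    rw [← Fin.snoc_init_self z₁, ← Fin.snoc_init_self z₂, hy, hs]
  -- image = the open band
  have himg : Φ '' RTerm.cyl G = {z : Fin (b + 1) → ℝ | (Fin.init z : Fin b → ℝ) ∈ G ∧
      α (Fin.init z) < z (Fin.last b) ∧ z (Fin.last b) < β (Fin.init z)} := by
    ext w
    simp only [mem_image, mem_setOf_eq]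
    constructor
    · rintro ⟨z, hz, rfl⟩
      have hy : Fin.init z ∈ G := hz.1
      have hσ := hσpos _ hy
      have hθ := hz.2
      refine ⟨by simpa [hΦ] using hy, ?_, ?_⟩
      · simp only [hΦ, Fin.init_snoc, Fin.snoc_last]
        nlinarith [hθ.1]
      · simp only [hΦ, Fin.init_snoc, Fin.snoc_last]
        nlinarith [hθ.2]
    · intro hw
      have hy : Fin.init w ∈ G := hw.1
      have hσ := hσpos _ hy
      refine ⟨Fin.snoc (Fin.init w) ((w (Fin.last b) - α (Fin.init w)) /
        (β (Fin.init w) - α (Fin.init w))), ⟨by simpa using hy, ?_, ?_⟩, ?_⟩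
      · simp only [Fin.snoc_last]
        exact div_pos (by linarith [hw.2.1]) hσ
      · simp only [Fin.snoc_last]
        rw [div_lt_one hσ]
        linarith [hw.2.2]
      · simp only [hΦ, Fin.init_snoc, Fin.snoc_last]
        rw [mul_div_cancel₀ _ hσ.ne', add_sub_cancel, Fin.snoc_init_self]
  have hcm : MeasurableSet (RTerm.cyl G) := (RTerm.isSemialgebraic_cyl hG).measurableSet_holds
  have key := (integrableOn_image_iff_integrableOn_abs_det_fderiv_smul volume hcm
    (fun z hz => (hderiv z hz.1).hasFDerivWithinAt) hinj f).1 (by rw [himg]; exact hf)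
  refine key.congr_fun (fun w hw => ?_) hcm
  show |(Φ' w).det| • f (Φ w) = _
  rw [hdet, smul_eq_mul, abs_of_pos (hσpos _ hw.1)]

/-- **`t`-degree-`≤ 1` rational integrands over an open band fold (g9).** `G` open
`ℚ`-semialgebraic, `α < β` `ℚ`-semialgebraic and differentiable on `G` (every cell of a CAD of
`r.domain` adapted to `q` reaches this after `exists_isOpen_contDiffOn` + null surgery), `r` on the
open band `{α(x) < t < β(x)}` with integrand `(Σ_{i≤n} pᵢ(x)tⁱ)/(q₀(x) + q₁(x)t)`, `pᵢ, q₀, q₁`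
`ℚ`-semialgebraic on `G`, denominator non-vanishing on the band. Then `r` folds
(`integrableOn_affinePullback` + `chart_numerator` + `foldsTo_cyl_ratDegOne` + `FoldsTo.of_affine`).
[KZ 2001, §1.2 rules (2),(3); this file §7, §10] -/
theorem foldsTo_band_ratDegOne (r : KZ.IntegralRep (b + 1)) {G : Set (Fin b → ℝ)}
    (hGo : IsOpen G) (hG : IsSemialgebraic ℚ G) {α β : (Fin b → ℝ) → ℝ}
    (hα : IsSemialgebraicFunOn ℚ G α) (hβ : IsSemialgebraicFunOn ℚ G β)
    (hαd : DifferentiableOn ℝ α G) (hβd : DifferentiableOn ℝ β G) (hlt : ∀ x ∈ G, α x < β x)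
    (hdom : r.domain = {z : Fin (b + 1) → ℝ | (Fin.init z : Fin b → ℝ) ∈ G ∧
      α (Fin.init z) < z (Fin.last b) ∧ z (Fin.last b) < β (Fin.init z)})
    (n : ℕ) {p : ℕ → (Fin b → ℝ) → ℝ} (hp : ∀ i, IsSemialgebraicFunOn ℚ G (p i))
    {q₀ q₁ : (Fin b → ℝ) → ℝ} (hq₀ : IsSemialgebraicFunOn ℚ G q₀)
    (hq₁ : IsSemialgebraicFunOn ℚ G q₁)
    (hqne : ∀ x ∈ G, ∀ t : ℝ, α x < t → t < β x → q₀ x + q₁ x * t ≠ 0)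
    (hint : EqOn r.integrand (fun z =>
      (∑ i ∈ Finset.range (n + 1), p i (Fin.init z) * z (Fin.last b) ^ i) /
        (q₀ (Fin.init z) + q₁ (Fin.init z) * z (Fin.last b))) r.domain) :
    ∃ (T : RTerm b) (hT : T.Admissible), FoldsTo r T hT := by
  have hcyl : IsSemialgebraic ℚ (RTerm.cyl G) := RTerm.isSemialgebraic_cyl hG
  have hσ : IsSemialgebraicFunOn ℚ G (fun x => β x - α x) := IsSemialgebraicFunOn.sub_holds hβ hα
  have hσpos : ∀ x ∈ G, 0 < β x - α x := fun x hx => sub_pos.2 (hlt x hx)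
  -- the §10 data of the pulled-back representation
  set c : ℕ → (Fin b → ℝ) → ℝ := fun j x =>
    chartCoeff n (fun i => p i x) (α x) (β x - α x) j with hc_def
  set A : (Fin b → ℝ) → ℝ := fun x => q₀ x + q₁ x * α x with hA_def
  set B : (Fin b → ℝ) → ℝ := fun x => q₁ x * (β x - α x) with hB_def
  have hc : ∀ j, IsSemialgebraicFunOn ℚ G (c j) := fun j =>
    isSemialgebraicFunOn_chartCoeff hG n hp hα hσ j
  have hA : IsSemialgebraicFunOn ℚ G A :=
    IsSemialgebraicFunOn.add_holds hq₀ (IsSemialgebraicFunOn.mul_holds hq₁ hα)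
  have hB : IsSemialgebraicFunOn ℚ G B := IsSemialgebraicFunOn.mul_holds hq₁ hσ
  have hmemt : ∀ x ∈ G, ∀ θ ∈ Ioo (0 : ℝ) 1,
      α x < α x + (β x - α x) * θ ∧ α x + (β x - α x) * θ < β x := by
    intro x hx θ hθ
    have hs := hσpos x hx
    constructor <;> nlinarith [hθ.1, hθ.2]
  have hne : ∀ x ∈ G, ∀ θ ∈ Ioo (0 : ℝ) 1, A x + B x * θ ≠ 0 := by
    intro x hx θ hθ
    have h := hqne x hx _ (hmemt x hx θ hθ).1 (hmemt x hx θ hθ).2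
    simp only [hA_def, hB_def]
    convert h using 1
    ring
  -- the pulled-back integrand, in §10 form
  set W : (Fin (b + 1) → ℝ) → ℝ := fun w =>
    (∑ j ∈ Finset.range (n + 1), c j (Fin.init w) * w (Fin.last b) ^ j) /
      (A (Fin.init w) + B (Fin.init w) * w (Fin.last b)) with hW
  have hWsa : IsSemialgebraicFunOn ℚ (RTerm.cyl G) W := by
    have hmem : ∀ w ∈ RTerm.cyl G, Fin.init w ∈ G := fun w hw => hw.1
    have hθ := isSemialgebraicFunOn_apply hcyl (Fin.last b)
    refine IsSemialgebraicFunOn.div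
      (isSemialgebraicFunOn_finset_sum hcyl _ fun j _ =>
        IsSemialgebraicFunOn.mul_holds ((hc j).comp_init_mono hcyl hmem)
          (isSemialgebraicFunOn_pow hcyl hθ j))
      (IsSemialgebraicFunOn.add_holds (hA.comp_init_mono hcyl hmem)
        (IsSemialgebraicFunOn.mul_holds (hB.comp_init_mono hcyl hmem) hθ))
      fun w hw => hne _ hw.1 _ hw.2
  -- it IS `(β − α) · f ∘ Φ` on the cylinder
  have hWeq : ∀ w ∈ RTerm.cyl G, W w = (β (Fin.init w) - α (Fin.init w)) *
      r.integrand (Fin.snoc (Fin.init w)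
        (α (Fin.init w) + (β (Fin.init w) - α (Fin.init w)) * w (Fin.last b))) := by
    intro w hw
    have hx : Fin.init w ∈ G := hw.1
    have hmem : (Fin.snoc (Fin.init w) (α (Fin.init w) + (β (Fin.init w) - α (Fin.init w)) *
        w (Fin.last b)) : Fin (b + 1) → ℝ) ∈ r.domain := by
      rw [hdom]
      refine ⟨by simpa using hx, ?_, ?_⟩
      · simpa using (hmemt _ hx _ hw.2).1
      · simpa using (hmemt _ hx _ hw.2).2
    rw [hint hmem]
    simp only [Fin.init_snoc, Fin.snoc_last, hW, hc_def, hA_def, hB_def]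
    rw [← chart_numerator n (fun i => p i (Fin.init w)) (α (Fin.init w))
      (β (Fin.init w) - α (Fin.init w)) (w (Fin.last b)), mul_div_assoc]
    congr 1
    ring
  have hWi : IntegrableOn W (RTerm.cyl G) := by
    have h := integrableOn_affinePullback hGo hG hαd hβd hlt (f := r.integrand) (hdom ▸ r.integrableOn)
    exact h.congr_fun (fun w hw => (hWeq w hw).symm) hcyl.measurableSet_holds
  let r' : KZ.IntegralRep (b + 1) := ⟨RTerm.cyl G, W, hcyl, hWsa, hWi⟩
  obtain ⟨T, hT, hf⟩ := foldsTo_cyl_ratDegOne r' hG n hc hA hB hne rfl (fun w _ => rfl)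
  exact ⟨T, hT, FoldsTo.of_affine (r := r) (r' := r') hGo hG hα hβ hαd hβd hlt hdom rfl
    (fun w hw => hWeq w hw) hf⟩

end AffineChart

/-! ## §13 (g9, NEW) `RegFolding 1` ⟸ BAND COVER a.e. (CAD) ∧ VANISHING ON UNBOUNDED BANDS

The top of the deg-`1` ladder. §13.1 extracts from `IsRationalDegLE 1 r` (a pair of
`MvPolynomial`s) the coefficient functions `pᵢ, q₀, q₁` of §11 (`lastCoeff`, pure algebra,
PROVED). §13.2 names the two remaining pieces — `BandCoverAE b` (every `ℚ`-semialgebraic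
`D ⊆ ℝᵇ⁺¹` is, up to a null set, a finite disjoint union of CAD bands over OPEN bases with
DIFFERENTIABLE sections: Basu–Pollack–Roy Cor. 5.7 + BCR §2.9) and `UnboundedBandVanish b` (a
`t`-degree-`≤ 1` rational integrand integrable over a `t`-unbounded band vanishes a.e.) — and PROVES
the glue `regFolding_one_of_pieces : BandCoverAE 1 → UnboundedBandVanish 1 → RegFolding 1`
(`foldsTo_of_cover` §4 + `foldsTo_band_ratDegOne` §11 + `FoldsTo.of_ae_eq`). §13.3/§13.4 then
prove both pieces (`unboundedBandVanish`, `bandCoverAE_one`), whence `regFolding_one`. -/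

section Extraction

variable {m : ℕ}

/-- The coefficient of `t^i` (`t` = the LAST variable) of `P : MvPolynomial (Fin (m+1)) ℚ`, as a
real polynomial function of the first `m` variables. -/
def lastCoeff (P : MvPolynomial (Fin (m + 1)) ℚ) (i : ℕ) (x : Fin m → ℝ) : ℝ :=
  ∑ s ∈ P.support, if s (Fin.last m) = i then
    ((MvPolynomial.coeff s P : ℚ) : ℝ) * ∏ j : Fin m, x j ^ s (Fin.castSucc j) else 0

/-- Finite products of `ℚ`-semialgebraic functions are `ℚ`-semialgebraic. [BCR 1998, Prop. 2.2.6] -/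
theorem isSemialgebraicFunOn_finset_prod {n : ℕ} {s : Set (Fin n → ℝ)} (hs : IsSemialgebraic ℚ s)
    {ι : Type*} (I : Finset ι) {f : ι → (Fin n → ℝ) → ℝ}
    (hf : ∀ i ∈ I, IsSemialgebraicFunOn ℚ s (f i)) :
    IsSemialgebraicFunOn ℚ s (fun x => ∏ i ∈ I, f i x) := by
  classical
  induction I using Finset.induction_on with
  | empty => exact (isSemialgebraicFunOn_ratCast hs 1).congr fun x _ => by simp
  | insert a I ha ih =>
    have h1 : IsSemialgebraicFunOn ℚ s (f a) := hf a (Finset.mem_insert_self a I)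
    have h2 := ih fun i hi => hf i (Finset.mem_insert_of_mem hi)
    refine (IsSemialgebraicFunOn.mul_holds h1 h2).congr fun x _ => ?_
    simp only [Pi.mul_apply, Finset.prod_insert ha]

/-- `lastCoeff P i` is `ℚ`-semialgebraic on every `ℚ`-semialgebraic set. -/
theorem isSemialgebraicFunOn_lastCoeff {S : Set (Fin m → ℝ)} (hS : IsSemialgebraic ℚ S)
    (P : MvPolynomial (Fin (m + 1)) ℚ) (i : ℕ) : IsSemialgebraicFunOn ℚ S (lastCoeff P i) := by
  classical
  unfold lastCoeff
  refine isSemialgebraicFunOn_finset_sum hS _ fun s _ => ?_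
  by_cases h : s (Fin.last m) = i
  · simp only [if_pos h]
    exact IsSemialgebraicFunOn.mul_holds (isSemialgebraicFunOn_ratCast hS (MvPolynomial.coeff s P))
      (isSemialgebraicFunOn_finset_prod hS _ fun j _ =>
        isSemialgebraicFunOn_pow hS (isSemialgebraicFunOn_apply hS j) _)
  · simp only [if_neg h]
    exact (isSemialgebraicFunOn_ratCast hS 0).congr fun x _ => by simp

end Extraction

end RegularisedLogLayer

end Summit.KontsevichZagierPeriods.RootDecompRelativeModAbsolute.Rung30571

end
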